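import Mathlib
import Summits.ValiantsHypothesis.ValiantsHypothesis.Theorems.RigidityForcesSymmetryRankRigidMinimalReprLaplaceDefs

/-!
# Tools for the four residual `a = 3` configurations of `LaplaceOptimal 5`: proportional bilinear forms, two-slot expansion
# (crux `RankRigidMinimalRepr`, stmt-ValiantsHypothesis-18034; frontier rung `LaplaceOptimalFive`, stmt-24813)

Two ingredients of the blueprint (evidence note NOTE-p8g11-24813, §v3, on stmt-24813) for the last four sorted labelled
three-slice configurations (`laplace_five_three_slices_residual`, `…LaplaceFiveAtMostTwoSlices.lean`):

* `functional_proportional` — a linear functional vanishing on the kernel of another is a multiple of it (coordinates);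
* `bilinear_proportional` — LEMMA C: if the bilinear form `xᵀ M y` vanishes wherever `xᵀ N y` does, then `M = κ N`;
  contrapositive use: `M ∉ ℂ N` gives `(x, y)` with `xᵀ N y = 0 ≠ xᵀ M y` (the last two covectors of the dual witness, the
  last pair term killed by `N`, the permanent `xᵀ M y ≠ 0`);
* `permanent_two_slot` — the TWO-SLOT EXPANSION of the `5 × 5` permanent in the programme's covector format:
  `per (φ_s(c))_{c,s} = Σ_{x,y} φ₃(x) · M₀₁₂(x,y) · φ₄(y)` with `M₀₁₂(x,y)` the fibre sum over the permutations with
  `σ 3 = x, σ 4 = y` of `φ₀(σ0) φ₁(σ1) φ₂(σ2)` (the `3 × 3` permanent of the first three covectors on the letters `≠ x, y`).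

General where free; no definitions.  HONEST FRAMING: infrastructure toward the frontier rung `LaplaceOptimalFive`
(stmt-24813), which stays OPEN; nothing here bears on `VP ≠ VNP`.
-/

set_option autoImplicit false

-- the mandated summit-side namespace repeats a component by design (single-problem summit)
set_option linter.dupNamespace false

namespace Summit.ValiantsHypothesis.ValiantsHypothesis.Theorems.RigidityForcesSymmetryRankRigidMinimalRepr

namespace LaplaceResidual

open Finset

variable {n : ℕ}

/-! ### §1 Proportional functionals and bilinear forms -/

/-- A linear functional (in coordinates) vanishing on the kernel of another is a multiple of it. -/
theorem functional_proportional (m v : Fin n → ℂ)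
    (h : ∀ y : Fin n → ℂ, (∑ j, v j * y j) = 0 → (∑ j, m j * y j) = 0) :
    ∃ c : ℂ, ∀ j, m j = c * v j := by
  classical
  by_cases hv : ∀ j, v j = 0
  · refine ⟨0, fun j => ?_⟩
    have := h (Pi.single j 1) (by simp [hv])
    simpa [Pi.single_apply] using this
  · push Not at hv
    obtain ⟨j0, hj0⟩ := hv
    refine ⟨m j0 / v j0, fun j => ?_⟩
    by_cases hjj : j = j0
    · subst hjj; field_simp
    · -- test vector `v j0 • e_j - v j • e_j0`
      have hy := h (fun k => if k = j then v j0 else if k = j0 then -v j else 0) ?_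
      · have e : ∑ k, m k * (if k = j then v j0 else if k = j0 then -v j else 0) = m j * v j0 - m j0 * v j := by
          rw [Finset.sum_eq_add_of_mem j j0 (mem_univ _) (mem_univ _) hjj]
          · simp [Ne.symm hjj]; ring
          · intro k _ hk
            simp [hk.1, hk.2]
        rw [e] at hy
        field_simp
        linear_combination hy
      · rw [Finset.sum_eq_add_of_mem j j0 (mem_univ _) (mem_univ _) hjj]
        · simp [Ne.symm hjj]; ring
        · intro k _ hk
          simp [hk.1, hk.2]

/-- **LEMMA C: proportional bilinear forms.**  If `xᵀ M y = 0` whenever `xᵀ N y = 0`, then `M = κ N` for some `κ`. -/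
theorem bilinear_proportional (M N : Fin n → Fin n → ℂ)
    (h : ∀ x y : Fin n → ℂ, (∑ i, ∑ j, x i * N i j * y j) = 0 → (∑ i, ∑ j, x i * M i j * y j) = 0) :
    ∃ κ : ℂ, ∀ i j, M i j = κ * N i j := by
  classical
  -- rows, pairs of rows, columns are proportional
  have key : ∀ (P : Fin n → Fin n → ℂ) (x y : Fin n → ℂ),
      (∑ i, ∑ j, x i * P i j * y j) = ∑ j, (∑ i, x i * P i j) * y j := by
    intro P x y
    rw [sum_comm]
    exact sum_congr rfl fun j _ => by rw [Finset.sum_mul]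
  have hx : ∀ x : Fin n → ℂ, ∃ c : ℂ, ∀ j, (∑ i, x i * M i j) = c * ∑ i, x i * N i j := by
    intro x
    refine functional_proportional (fun j => ∑ i, x i * M i j) (fun j => ∑ i, x i * N i j) (fun y hy => ?_)
    have := h x y (by rw [key]; exact hy)
    rw [key] at this
    exact this
  have hrow : ∀ i, ∃ c : ℂ, ∀ j, M i j = c * N i j := by
    intro i
    obtain ⟨c, hc⟩ := hx (Pi.single i 1)
    exact ⟨c, fun j => by simpa [Pi.single_apply] using hc j⟩
  have hrow2 : ∀ i i', i ≠ i' → ∃ c : ℂ, ∀ j, M i j + M i' j = c * (N i j + N i' j) := by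
    intro i i' hii
    obtain ⟨c, hc⟩ := hx (fun k => if k = i then 1 else if k = i' then 1 else 0)
    refine ⟨c, fun j => ?_⟩
    have e1 : ∑ k, (if k = i then (1:ℂ) else if k = i' then 1 else 0) * M k j = M i j + M i' j := by
      rw [Finset.sum_eq_add_of_mem i i' (mem_univ _) (mem_univ _) hii]
      · simp [Ne.symm hii]
      · intro k _ hk; simp [hk.1, hk.2]
    have e2 : ∑ k, (if k = i then (1:ℂ) else if k = i' then 1 else 0) * N k j = N i j + N i' j := by
      rw [Finset.sum_eq_add_of_mem i i' (mem_univ _) (mem_univ _) hii]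
      · simp [Ne.symm hii]
      · intro k _ hk; simp [hk.1, hk.2]
    have := hc j
    rw [e1, e2] at this
    exact this
  have hcol : ∀ j, ∃ d : ℂ, ∀ i, M i j = d * N i j := by
    intro j
    refine functional_proportional (fun i => M i j) (fun i => N i j) (fun x hx0 => ?_)
    have := h x (Pi.single j 1) (by
      simp only [Pi.single_apply, mul_ite, mul_one, mul_zero, Finset.sum_ite_eq', mem_univ, if_true]
      rw [← hx0]; exact sum_congr rfl fun i _ => by ring)
    simp only [Pi.single_apply, mul_ite, mul_one, mul_zero, Finset.sum_ite_eq', mem_univ, if_true] at this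
    rw [← this]; exact sum_congr rfl fun i _ => by ring
  -- assemble
  by_cases hN : ∀ i j, N i j = 0
  · refine ⟨0, fun i j => ?_⟩
    obtain ⟨c, hc⟩ := hrow i
    rw [hc j, hN i j]; ring
  · push Not at hN
    obtain ⟨i0, j0, h0⟩ := hN
    set κ := M i0 j0 / N i0 j0 with hκ
    have hκ0 : M i0 j0 = κ * N i0 j0 := by rw [hκ]; field_simp
    refine ⟨κ, fun i j => ?_⟩
    obtain ⟨ci, hci⟩ := hrow i
    obtain ⟨ci0, hci0⟩ := hrow i0
    obtain ⟨dj, hdj⟩ := hcol j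
    obtain ⟨dj0, hdj0⟩ := hcol j0
    have hci0κ : ci0 = κ := by
      have := hci0 j0; rw [hκ0] at this
      exact (mul_right_cancel₀ h0 this).symm
    by_cases h1 : N i j0 = 0
    · by_cases h2 : N i0 j = 0
      · -- use the pair of rows `i, i0`
        by_cases hii : i = i0
        · rw [hii, hci0 j, hci0κ]
        obtain ⟨c', hc'⟩ := hrow2 i i0 hii
        have hc'κ : c' = κ := by
          have := hc' j0
          rw [hci j0, h1, hκ0] at this
          have : κ * N i0 j0 = c' * N i0 j0 := by linear_combination this
          exact (mul_right_cancel₀ h0 this).symm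
        have := hc' j
        rw [hc'κ, hci0 j, hci0κ, h2] at this
        linear_combination this
      · -- column `j` through `(i0, j)`
        have hdjκ : dj = κ := by
          have := hdj i0; rw [hci0 j, hci0κ] at this
          exact (mul_right_cancel₀ h2 this).symm
        rw [hdj i, hdjκ]
    · -- row `i` through `(i, j0)`
      have hciκ : ci = κ := by
        have := hdj0 i; rw [hci j0] at this
        have hdj0κ : dj0 = κ := by
          have := hdj0 i0; rw [hκ0] at this
          exact (mul_right_cancel₀ h0 this).symm
        rw [hdj0κ] at this
        exact mul_right_cancel₀ h1 this
      rw [hci j, hciκ]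

/-! ### §2 The two-slot expansion of the `5 × 5` permanent -/

/-- **Two-slot expansion.**  In the covector format `per (φ_s(c))_{c,s}`:
`per = Σ_{x,y} φ₃(x) · (Σ_{σ : σ 3 = x, σ 4 = y} φ₀(σ0) φ₁(σ1) φ₂(σ2)) · φ₄(y)`. -/
theorem permanent_two_slot (φ : Fin 5 → Fin 5 → ℂ) :
    (Matrix.of fun c s => φ s c).permanent =
      ∑ x, ∑ y, φ 3 x * (∑ σ : Equiv.Perm (Fin 5),
        if σ 3 = x ∧ σ 4 = y then φ 0 (σ 0) * φ 1 (σ 1) * φ 2 (σ 2) else 0) * φ 4 y := by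
  classical
  unfold Matrix.permanent
  -- move the sums over `x, y` inside
  have hR : ∀ σ : Equiv.Perm (Fin 5), ∑ x, ∑ y, φ 3 x * (if σ 3 = x ∧ σ 4 = y then φ 0 (σ 0) * φ 1 (σ 1) * φ 2 (σ 2) else 0) *
      φ 4 y = φ 0 (σ 0) * φ 1 (σ 1) * φ 2 (σ 2) * φ 3 (σ 3) * φ 4 (σ 4) := by
    intro σ
    rw [Finset.sum_eq_single (σ 3)]
    · rw [Finset.sum_eq_single (σ 4)]
      · rw [if_pos ⟨rfl, rfl⟩]; ring
      · intro y _ hy; rw [if_neg (fun h => hy h.2.symm)]; ring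
      · intro h; exact absurd (mem_univ _) h
    · intro x _ hx
      refine sum_eq_zero fun y _ => ?_
      rw [if_neg (fun h => hx h.1.symm)]; ring
    · intro h; exact absurd (mem_univ _) h
  calc ∑ σ : Equiv.Perm (Fin 5), ∏ i, (Matrix.of fun c s => φ s c) (σ i) i
      = ∑ σ : Equiv.Perm (Fin 5), φ 0 (σ 0) * φ 1 (σ 1) * φ 2 (σ 2) * φ 3 (σ 3) * φ 4 (σ 4) := by
        refine sum_congr rfl fun σ _ => ?_
        simp only [Matrix.of_apply, Fin.prod_univ_five]
    _ = ∑ σ : Equiv.Perm (Fin 5), ∑ x, ∑ y, φ 3 x *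
          (if σ 3 = x ∧ σ 4 = y then φ 0 (σ 0) * φ 1 (σ 1) * φ 2 (σ 2) else 0) * φ 4 y := by
        exact sum_congr rfl fun σ _ => (hR σ).symm
    _ = _ := by
        rw [sum_comm]
        refine sum_congr rfl fun x _ => ?_
        rw [sum_comm]
        refine sum_congr rfl fun y _ => ?_
        rw [mul_sum, sum_mul]

end LaplaceResidual

end Summit.ValiantsHypothesis.ValiantsHypothesis.Theorems.RigidityForcesSymmetryRankRigidMinimalRepr
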